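import Literature.AlgebraicGeometry.HodgeTheory.PolarizedLimitMixedHodgeStructureApproximateRescaledLimit
import Literature.AlgebraicGeometry.HodgeTheory.PolarizedLimitMixedHodgeStructureQuantitativeTransversality
import Literature.AlgebraicGeometry.HodgeTheory.PolarizedLimitMixedHodgeStructureBoundedPointTransfer
import Literature.AlgebraicGeometry.HodgeTheory.PolarizedLimitMixedHodgeStructureIntegralClassesWeightBound
import Literature.AlgebraicGeometry.Motives.HodgeStructureApproximateHodgeClasses
import Mathlib.Analysis.SpecialFunctions.Exp
import HarnessLib

/-!
# Cattani–Deligne–Kaplan, Theorem 2.16 (the approximate version of Theorem 2.5), for a one-variable nilpotent orbit: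
# integral classes of bounded Hodge norm EXPONENTIALLY CLOSE to `F^p` near the puncture are finite in number, lie in `W_k`,
# are monodromy invariant, lie in `F^p` of the limit — hence are genuine Hodge classes at every point of the orbit

Topic `Literature/AlgebraicGeometry/HodgeTheory` (namespace `…HodgeTheory.PolarizedLimitMixedHodgeStructure`).  Theorems only; no
definition, no instance, no named fact (D-0026 net debt `0`).  This file ASSEMBLES the story `Motives/HodgeStructureApproximateHodgeClasses`
(CDK 2.15 / 2.17 (iii)) → `…ApproximateRescaledLimit` (CDK Prop. 4.7 at `d = 1` with the error term) → `…QuantitativeTransversality`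
(CDK Prop. 4.8 at `d = 1`) → `…BoundedPointTransfer` (2.16 Remark (ii), 4.9) with the lattice files `…IntegralClassesWeightBound`
(CDK 4.3, 4.6) and `Motives/HodgeStructureHodgeNormLattice`.  It is the approximate counterpart of the tree's
`…IntegralHodgeClassesNearPuncture` (Thm. 2.5, exact Hodge classes).

PRINTED SOURCE, VERBATIM. E. Cattani, P. Deligne, A. Kaplan, *On the locus of Hodge classes*, J. Amer. Math. Soc. 8 (1995) 483–506,
p. 492: **Theorem 2.16.** «Assume `𝒱` of weight `0`. Given `K` and `α > 0`, there is a constant `A₁` (depending on `K`, `α`, and `𝒱`)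
such that (i) There are only finitely many elements `v ∈ V_ℤ` such that, at some point `z` with `0 ≤ x_j ≤ 1` and `inf(y_j) ≥ A₁`,
`‖v‖_{Φ(z)} ≤ K` and, relative to the Hodge metric at `Φ(z)`, (2.16.1) `v ∼_z Φ⁰(z)`. (ii) Any such `v` is in `W₀`. (iii) If a fixed
`v` satisfies (i) at a sequence of points `z` with `0 ≤ x_j ≤ 1` and `inf(y_j) → ∞`, then `v` is in `F⁰` for some limiting Hodge
filtration `F`.»  2.15 (p. 491): «`v ∼_Y F` if … `v + w ∈ F` with `|w| ≤ exp(−αY)|v|`».  2.19 (p. 493): «it hence suffices to show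
that given a sequence `(u(n), z(n))` with `u(n) ∈ V_ℤ`, `‖u(n)‖_{Φ(z(n))} ≤ K`, and `u(n) ∼_z Φ⁰(z(n))` in the Hodge norm at `z(n)`,
`0 ≤ x_i(n) ≤ 1`, `inf(y_i(n)) → ∞`, it has a subsequence for which `u(n)` is constant, in `W₀`, and in `F⁰` for some limiting Hodge
filtration `F`.»  4.9 (p. 505), `d = 1`: «Being bounded and integral, `u(n)` can take only finitely many values. Taking a subsequence
for which `z(n) − iτ₁(n)θ¹` tends to a limit, we find that `u` is in the corresponding `Φ⁰`. It is in `W₀` by 4.3. This proves (4.1.2),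
while (4.1.4) [`T_j u = 0`] results from 4.7.»

WHAT IS FORMALIZED — the case `r = 1` of Thm. 2.16 for the NILPOTENT ORBIT `θ(z) = exp(zN)·F` of a polarized limit mixed Hodge
structure `L = (W, F, N, Q)` of weight `k = p + p` on a finite-dimensional `ℚ`-space `V` (`Im z > β`), an arbitrary integral structure
`Λ ⊆ V` (finitely generated subgroup), real parts `|Re z| ≤ R` (the printed `0 ≤ x ≤ 1`), Hodge norm bound `‖1 ⊗ u‖_{θ(z)} ≤ K`, and
the closeness `u ∼_{α,z} F^pθ(z)`: SOME `f ∈ F^pθ(z)` has `‖1 ⊗ u − f‖_{θ(z)} ≤ exp(−α Im z)‖1 ⊗ u‖_{θ(z)}`.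
**Theorem** (`exists_threshold_approximate_integral_hodgeClasses`): given `K`, `α > 0`, `R` there is `A₁` such that for every `u ∈ Λ` which,
at SOME point `θ(z)` with `Im z ≥ A₁`, `|Re z| ≤ R`, has `‖1 ⊗ u‖_{θ(z)} ≤ K` and `u ∼_{α,z} F^pθ(z)`:
* (ii) `u ∈ W_k` (CDK 4.3: `…IntegralClassesWeightBound`);
* (4.1.4) **`N u = 0`** — offenders `u_n` have constant top class along a subsequence (CDK 4.6), `N`-invariant by the compactness step
  (CDK 4.7 with error, `…ApproximateRescaledLimit`), so `‖N u_n‖_{θ(z_n)} ≤ (C/Im z_n) e^{−α Im z_n} K` (CDK 4.8, `…QuantitativeTransversality`),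
  `|1 ⊗ N u_n|₀ ≤ B (Im z_n)^m e^{−α Im z_n}` (2.16 Remark (ii)), impossible in the LATTICE `N(Λ)` unless `N u_n = 0` («being
  constant, it is also killed by `T₁` (cf. 4.8)» — here through discreteness);
* (i) **`|1 ⊗ u|₀ ≤ C_fin`**, so the set of such `u` is FINITE — transfer to the bounded point `θ(Re z + iA₀)` (CDK 4.9,
  `…BoundedPointTransfer`), where `u` is again an approximate Hodge class, so `‖1 ⊗ u‖² ≤ 3Q(u, u) ≤ 6‖1 ⊗ u‖²_{θ(z)} ≤ 6K²`
  (CDK 2.17 (iii), `Motives/HodgeStructureApproximateHodgeClasses`) and the norms at the bounded points are uniformly equivalent to `|·|₀`;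
* (iii) **`1 ⊗ u ∈ F^p`** for the LIMIT Hodge filtration, hence (as `N u = 0`, `u` real) **`u` is of type `(p, p)` at EVERY point of the
  orbit** — an integral class exponentially close to being Hodge near the puncture IS Hodge («`v` is in `F⁰` for some limiting Hodge
  filtration»; for `N v = 0` all limiting filtrations `exp(zN)·F` agree on `v`).

NOT HERE: several variables (`r > 1`), general period maps `Φ = e^{zN} e^{Γ(s)}·F` (2.3, 2.7), the algebraicity statements 1.1–1.5.

## References

* [CattaniDeligneKaplan1995] E. Cattani, P. Deligne, A. Kaplan, *On the locus of Hodge classes*, J. Amer. Math. Soc. 8 (1995)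
  483–506: 2.15 (p. 491), Thm. 2.16, 2.17, 2.19 (pp. 492–493), Props. 4.3, 4.6, 4.7, 4.8, 4.9 (pp. 501–505).
* [CattaniKaplanSchmid1987] E. Cattani, A. Kaplan, W. Schmid, LNM 1246 (1987): §3 Cor. (3.7).
* [Schmid1973] W. Schmid, Invent. Math. 22 (1973): Thm. (6.6) (cite only).
-/

noncomputable section

open scoped TensorProduct ComplexOrder
open Filter Topology

namespace Literature.AlgebraicGeometry

open Module
open Motives Motives.MixedHodgeStructure Motives.HodgeStructure
open Motives.HodgeStructure (conj ofRat ofRat_apply conj_ofRat)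

universe u

variable {V : Type u} [AddCommGroup V] [Module ℚ V] [FiniteDimensional ℚ V] {k : ℤ}

namespace HodgeTheory

namespace PolarizedLimitMixedHodgeStructure

variable (L : PolarizedLimitMixedHodgeStructure V k)

/-! ## §0 Tools: `y^n e^{−αy} → 0`, `1 ⊗ N u = N_ℂ(1 ⊗ u)` -/

/-- `y ↦ y^n e^{−αy}` tends to `0` at `+∞` (`α > 0`). [folklore] -/
private theorem tendsto_pow_mul_exp_neg_mul {α : ℝ} (hα : 0 < α) (n : ℕ) :
    Tendsto (fun y : ℝ => y ^ n * Real.exp (-α * y)) atTop (𝓝 0) := by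
  have h := ((Real.tendsto_pow_mul_exp_neg_atTop_nhds_zero n).comp (tendsto_id.const_mul_atTop hα)).const_mul ((α ^ n)⁻¹)
  rw [mul_zero] at h
  refine h.congr fun y => ?_
  simp only [Function.comp_apply, id_eq, mul_pow]
  field_simp

/-- An explicit threshold: `y^n e^{−αy} ≤ ε` for `y ≥ A`. [folklore] -/
private theorem exists_forall_pow_mul_exp_le {α : ℝ} (hα : 0 < α) (n : ℕ) {ε : ℝ} (hε : 0 < ε) :
    ∃ A : ℝ, ∀ y : ℝ, A ≤ y → y ^ n * Real.exp (-α * y) ≤ ε := by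
  have h := (tendsto_pow_mul_exp_neg_mul hα n).eventually (Iic_mem_nhds hε)
  obtain ⟨A, hA⟩ := eventually_atTop.1 h
  exact ⟨A, fun y hy => hA y hy⟩

/-- `1 ⊗ (N u) = N_ℂ (1 ⊗ u)`. [folklore] -/
private theorem ofRat_N (u : V) : ofRat (L.N u) = L.N.baseChange ℂ (ofRat u) := by
  rw [ofRat_apply, ofRat_apply, LinearMap.baseChange_tmul]

/-- `1 ⊗ u ∈ W_{m,ℂ} ↔ u ∈ W_m`. [folklore] -/
private theorem ofRat_mem_baseChange_W_iff {m : ℤ} {u : V} : ofRat u ∈ (L.W m).baseChange ℂ ↔ u ∈ L.W m := by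
  rw [ofRat_apply]
  exact ⟨fun h => MixedHodgeStructure.mem_of_one_tmul_mem_baseChange _ h, fun h => Submodule.tmul_mem_baseChange_of_mem 1 h⟩

/-! ## §1 CDK Thm. 2.16 (ii) and (4.1.4): `u ∈ W_k` and `N u = 0` -/

/-- **CDK Thm. 2.16 (ii) with (4.1.4), `r = 1`: given `K`, `α > 0`, `R`, there is `A` such that every `u ∈ Λ` which at some point `θ(z)`
with `Im z ≥ A`, `|Re z| ≤ R` has Hodge norm `‖1 ⊗ u‖_{θ(z)} ≤ K` and is `e^{−α Im z}`-close to `F^pθ(z)` lies in `W_k` and satisfies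
`N u = 0`.**  Proof (CDK 2.19 / 4.1, by contradiction): offenders `(u_n, z_n)` with `Im z_n → ∞` have `u_n ∈ W_k` (4.3), top classes
`π̂_k(1 ⊗ u_n)` in a finite set (4.6), constant `= û` along a subsequence, `N û = 0` (4.7 with error term), hence `‖N(1 ⊗ u_n)‖_{θ(z_n)} ≤
(C/Im z_n) e^{−α Im z_n} K` (4.8) and `|1 ⊗ N u_n|₀ ≤ B (Im z_n)^m · C e^{−α Im z_n} K → 0` (2.16 Remark (ii)); but `N u_n ≠ 0` lies in the
lattice `N(Λ)`, whose nonzero vectors have `|·|₀ ≥ c > 0`. [cite: CattaniDeligneKaplan1995, Thm. 2.16 (ii) (p. 492), 2.19 (p. 493), 4.1, Props. 4.3, 4.6–4.8 (pp. 499–505)]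
[cite: Schmid1973, Thm. (6.6) (cite only)] -/
theorem exists_forall_mem_W_and_N_eq_zero_of_hodgeNorm_sub_le_exp {p : ℤ} (hpk : p + p = k) (Λ : Submodule ℤ V) (hΛ : Λ.FG)
    (K R : ℝ) {α : ℝ} (hα : 0 < α) :
    ∃ A : ℝ, L.normThreshold < A ∧ ∀ u ∈ Λ, ∀ (z : ℂ) (hz : L.normThreshold < z.im), A ≤ z.im → |z.re| ≤ R →
      (L.nilpotentOrbitPolarization z (L.orbitThreshold_lt_im hz)).hodgeNorm (ofRat u) ≤ K →
      (∃ f ∈ (L.nilpotentOrbit z (L.orbitThreshold_lt_im hz)).F p,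
        (L.nilpotentOrbitPolarization z (L.orbitThreshold_lt_im hz)).hodgeNorm (ofRat u - f) ≤
          Real.exp (-α * z.im) * (L.nilpotentOrbitPolarization z (L.orbitThreshold_lt_im hz)).hodgeNorm (ofRat u)) →
      u ∈ L.W k ∧ L.N u = 0 := by
  classical
  obtain ⟨A_W, hA_W⟩ := L.exists_forall_mem_W_of_hodgeNorm_ofRat_le Λ hΛ K
  -- it suffices to find a threshold for `N u = 0`
  suffices h : ∃ A : ℝ, ∀ u ∈ Λ, ∀ (z : ℂ) (hz : L.normThreshold < z.im), A ≤ z.im → |z.re| ≤ R →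
      (L.nilpotentOrbitPolarization z (L.orbitThreshold_lt_im hz)).hodgeNorm (ofRat u) ≤ K →
      (∃ f ∈ (L.nilpotentOrbit z (L.orbitThreshold_lt_im hz)).F p,
        (L.nilpotentOrbitPolarization z (L.orbitThreshold_lt_im hz)).hodgeNorm (ofRat u - f) ≤
          Real.exp (-α * z.im) * (L.nilpotentOrbitPolarization z (L.orbitThreshold_lt_im hz)).hodgeNorm (ofRat u)) → L.N u = 0 by
    obtain ⟨A, hA⟩ := h
    refine ⟨max (max A_W A) (L.normThreshold + 1), lt_of_lt_of_le (lt_add_one _) (le_max_right _ _),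
      fun u hu z hz hAz hRz hK happ => ⟨?_, ?_⟩⟩
    · exact hA_W u hu z hz (((le_max_left _ _).trans (le_max_left _ _)).trans hAz) hK
    · exact hA u hu z hz (((le_max_right _ _).trans (le_max_left _ _)).trans hAz) hRz hK happ
  -- constants
  obtain ⟨C₃, hC₃, A₃, h₃⟩ := L.exists_forall_hodgeNorm_N_le_div_mul_hodgeNorm_sub_of_N_deligneEProj_eq_zero hpk
  obtain ⟨B, hB, m, hBm⟩ := L.exists_forall_referenceNorm_le_pow_mul_hodgeNorm_nilpotentOrbit R
  obtain ⟨c, hc, hcΛ⟩ := (L.deltaSplit.sharpPolarization L.isSplitOverR_deltaSplit).exists_pos_forall_le_hodgeNorm_ofRat_of_fg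
    (Λ.map (L.N.restrictScalars ℤ)) (hΛ.map _)
  by_contra hcon
  push Not at hcon
  -- a sequence of offenders `(u n, z n)` with `Im (z n) ≥ max (max A_W A₃) n`
  choose u huΛ z hz hAz hRz huK happ hNu using fun n : ℕ => hcon (max (max A_W A₃) n)
  choose f hf hfε using happ
  have hK0 : 0 ≤ K := (HodgeStructure.Polarization.hodgeNorm_nonneg _ _).trans (huK 0)
  have huW : ∀ n, u n ∈ L.W k := fun n => hA_W (u n) (huΛ n) (z n) (hz n) (((le_max_left _ _).trans (le_max_left _ _)).trans (hAz n)) (huK n)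
  have hA₃n : ∀ n, A₃ ≤ (z n).im := fun n => ((le_max_right _ _).trans (le_max_left _ _)).trans (hAz n)
  have hlim : Tendsto (fun n => (z n).im) atTop atTop :=
    tendsto_atTop_mono (fun n => (le_max_right _ _).trans (hAz n)) tendsto_natCast_atTop_atTop
  -- the top classes `g n = π̂_k (1 ⊗ u n)` lie in a finite set: one value `û` is taken infinitely often
  set g : ℕ → ℂ ⊗[ℚ] V := fun n => L.deltaSplit.toMixedHodgeStructure.deligneEProj k (ofRat (u n)) with hg_def
  have hS := L.finite_image_deligneEProj_self_of_hodgeNorm_le Λ hΛ K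
  set S := {x : ℂ ⊗[ℚ] V | ∃ u ∈ Λ, u ∈ L.W k ∧ (∃ (z : ℂ) (hz : L.normThreshold < z.im),
      (L.nilpotentOrbitPolarization z (L.orbitThreshold_lt_im hz)).hodgeNorm (ofRat u) ≤ K) ∧
      L.deltaSplit.toMixedHodgeStructure.deligneEProj k (ofRat u) = x} with hS_def
  have hgS : ∀ n, g n ∈ S := fun n => ⟨u n, huΛ n, huW n, ⟨z n, hz n, huK n⟩, rfl⟩
  haveI : Finite S := hS.to_subtype
  obtain ⟨⟨û, hûS⟩, hinf⟩ := Finite.exists_infinite_fiber fun n : ℕ => (⟨g n, hgS n⟩ : S)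
  have hinf' : Set.Infinite {n : ℕ | g n = û} := by
    have h := Set.infinite_coe_iff.1 hinf
    refine Set.Infinite.mono (fun n hn => ?_) h
    simp only [Set.mem_preimage, Set.mem_singleton_iff, Subtype.mk.injEq] at hn
    exact hn
  obtain ⟨φ, hφ, hgφ⟩ := extraction_of_frequently_atTop (Nat.frequently_atTop_iff_infinite.2 hinf')
  -- the compactness step with error term (CDK 4.7): `N û = 0`
  have hlimφ : Tendsto (fun j => (z (φ j)).im) atTop atTop := hlim.comp hφ.tendsto_atTop
  have hû : L.N.baseChange ℂ û = 0 :=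
    (L.sl2_invariant_of_deligneEProj_eq_const_of_hodgeNorm_sub_le_exp hpk (fun j => ofRat (u (φ j))) (fun j => z (φ j))
      (fun j => hz (φ j)) hlimφ (fun j => huK (φ j)) (fun j => conj_ofRat _)
      (fun j => L.ofRat_mem_baseChange_W_iff.2 (huW (φ j))) (fun j => f (φ j)) (fun j => hf (φ j)) hα (fun j => hfε (φ j))
      (fun j => hgφ j)).1
  -- CDK 4.8 + 2.16 Remark (ii): `|1 ⊗ N u_{φ j}|₀ ≤ B y^m · (C₃ / y) · e^{−αy} K`
  have hsmall : ∀ j, L.referenceNorm (ofRat (L.N (u (φ j)))) ≤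
      B * C₃ * K * ((z (φ j)).im ^ m * Real.exp (-α * (z (φ j)).im)) := by
    intro j
    set n := φ j with hn_def
    have hz0 : 0 < (z n).im := L.im_pos_of_normThreshold_lt (hz n)
    have hy1 : 1 ≤ (z n).im := L.one_le_im_of_normThreshold_lt (hz n)
    set Pz := L.nilpotentOrbitPolarization (z n) (L.orbitThreshold_lt_im (hz n)) with hPz_def
    have hNtop : L.N.baseChange ℂ (L.deltaSplit.toMixedHodgeStructure.deligneEProj k (ofRat (u n))) = 0 := by
      rw [show L.deltaSplit.toMixedHodgeStructure.deligneEProj k (ofRat (u n)) = û from hgφ j, hû]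
    have h1 : Pz.hodgeNorm (L.N.baseChange ℂ (ofRat (u n))) ≤ C₃ / (z n).im * Pz.hodgeNorm (ofRat (u n) - f n) :=
      h₃ (z n) (hz n) (hA₃n n) _ (conj_ofRat _) (L.ofRat_mem_baseChange_W_iff.2 (huW n)) hNtop (f n) (hf n)
    have h2 : Pz.hodgeNorm (ofRat (u n) - f n) ≤ Real.exp (-α * (z n).im) * K :=
      (hfε n).trans (mul_le_mul_of_nonneg_left (huK n) (Real.exp_pos _).le)
    have h3 : L.referenceNorm (L.N.baseChange ℂ (ofRat (u n))) ≤ B * (z n).im ^ m * Pz.hodgeNorm (L.N.baseChange ℂ (ofRat (u n))) :=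
      hBm (z n) (hz n) (hRz n) _
    have h4 : C₃ / (z n).im ≤ C₃ := div_le_self hC₃ hy1
    rw [L.ofRat_N]
    calc L.referenceNorm (L.N.baseChange ℂ (ofRat (u n))) ≤ B * (z n).im ^ m * Pz.hodgeNorm (L.N.baseChange ℂ (ofRat (u n))) := h3
      _ ≤ B * (z n).im ^ m * (C₃ / (z n).im * (Real.exp (-α * (z n).im) * K)) :=
          mul_le_mul_of_nonneg_left (h1.trans (mul_le_mul_of_nonneg_left h2 (div_nonneg hC₃ hz0.le))) (by positivity)
      _ ≤ B * (z n).im ^ m * (C₃ * (Real.exp (-α * (z n).im) * K)) :=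
          mul_le_mul_of_nonneg_left (mul_le_mul_of_nonneg_right h4 (by positivity)) (by positivity)
      _ = B * C₃ * K * ((z n).im ^ m * Real.exp (-α * (z n).im)) := by ring
  -- the lattice `N(Λ)`: `|1 ⊗ N u_{φ j}|₀ ≥ c`
  have hbig : ∀ j, c ≤ L.referenceNorm (ofRat (L.N (u (φ j)))) := fun j =>
    hcΛ (L.N (u (φ j))) ⟨u (φ j), huΛ (φ j), rfl⟩ (hNu (φ j))
  -- contradiction for `j` large
  have hev : ∀ᶠ j in atTop, (z (φ j)).im ^ m * Real.exp (-α * (z (φ j)).im) < c / (B * C₃ * K + 1) :=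
    ((tendsto_pow_mul_exp_neg_mul hα m).comp hlimφ).eventually (Iio_mem_nhds (by positivity))
  obtain ⟨j, hj⟩ := hev.exists
  have h := (hbig j).trans (hsmall j)
  have hBCK : 0 ≤ B * C₃ * K := by positivity
  have h' : B * C₃ * K * ((z (φ j)).im ^ m * Real.exp (-α * (z (φ j)).im)) ≤ B * C₃ * K * (c / (B * C₃ * K + 1)) :=
    mul_le_mul_of_nonneg_left hj.le hBCK
  have h'' : B * C₃ * K * (c / (B * C₃ * K + 1)) < c := by
    rw [mul_div_assoc', div_lt_iff₀ (by positivity)]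
    nlinarith
  linarith

/-! ## §2 CDK Thm. 2.16 (i): the fixed norm of such classes is bounded, so they are finite in number -/

/-- **CDK Thm. 2.16 (i), `r = 1`, the bound: there are `A` and `C` with `|1 ⊗ u|₀ ≤ C` for every `u ∈ Λ` which at some `θ(z)`, `Im z ≥ A`,
`|Re z| ≤ R`, has `‖1 ⊗ u‖_{θ(z)} ≤ K` and is `e^{−α Im z}`-close to `F^pθ(z)`.**  Proof (4.9 at `d = 1`): by §1 `N u = 0`; transferring to
the bounded point `z' = Re z + iA₀` (`…BoundedPointTransfer`), `1 ⊗ u` is `δ`-close to `F^pθ(z')` relative to `‖1 ⊗ u‖_{θ(z')}` with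
`δ = C (Im z)^n e^{−α Im z} ≤ 1/8`; by 2.17 (iii) at `θ(z')` and at `θ(z)`: `‖1 ⊗ u‖²_{θ(z')} ≤ 3Q(u,u) ≤ 6‖1 ⊗ u‖²_{θ(z)} ≤ 6K²`, and
`|·|₀ ≤ C_e‖·‖_{θ(z')}` uniformly («its Hodge norm at both places is close to `Q(u(n), u(n))^{1/2}` and hence is bounded»).
[cite: CattaniDeligneKaplan1995, Thm. 2.16 (i) (p. 492), 2.17 (iii), 4.9 (p. 505)] [cite: Schmid1973, Thm. (6.6) (cite only)] -/
theorem exists_forall_referenceNorm_ofRat_le_of_hodgeNorm_sub_le_exp {p : ℤ} (hpk : p + p = k) (Λ : Submodule ℤ V) (hΛ : Λ.FG)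
    (K R : ℝ) {α : ℝ} (hα : 0 < α) :
    ∃ A : ℝ, L.normThreshold < A ∧ ∃ C : ℝ, ∀ u ∈ Λ, ∀ (z : ℂ) (hz : L.normThreshold < z.im), A ≤ z.im → |z.re| ≤ R →
      (L.nilpotentOrbitPolarization z (L.orbitThreshold_lt_im hz)).hodgeNorm (ofRat u) ≤ K →
      (∃ f ∈ (L.nilpotentOrbit z (L.orbitThreshold_lt_im hz)).F p,
        (L.nilpotentOrbitPolarization z (L.orbitThreshold_lt_im hz)).hodgeNorm (ofRat u - f) ≤
          Real.exp (-α * z.im) * (L.nilpotentOrbitPolarization z (L.orbitThreshold_lt_im hz)).hodgeNorm (ofRat u)) →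
      L.referenceNorm (ofRat u) ≤ C := by
  obtain ⟨A₁, hA₁, hWN⟩ := L.exists_forall_mem_W_and_N_eq_zero_of_hodgeNorm_sub_le_exp hpk Λ hΛ K R hα
  set A₀ : ℝ := L.normThreshold + 1 with hA₀_def
  have hA₀ : L.normThreshold < A₀ := lt_add_one _
  have hA₀0 : 0 < A₀ := L.normThreshold_pos.trans hA₀
  obtain ⟨B_T, hB_T, n_T, hT⟩ := L.exists_forall_referenceNorm_sub_exp_apply_le_of_N_apply_eq_zero R
  obtain ⟨C_e, hC_e, hCe⟩ := L.exists_forall_hodgeNorm_nilpotentOrbit_le_and_referenceNorm_le R A₀ hA₀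
  obtain ⟨B₂, hB₂, n₂, hB2⟩ := L.exists_forall_hodgeNorm_nilpotentOrbit_le_pow_mul_referenceNorm R
  obtain ⟨A₂, hA₂⟩ := exists_forall_pow_mul_exp_le hα (n_T + n₂) (ε := 1 / (8 * (C_e * C_e * B_T * B₂ + 1))) (by positivity)
  obtain ⟨A₃, hA₃⟩ := exists_forall_pow_mul_exp_le hα 0 (ε := 1 / 8) (by norm_num)
  refine ⟨max (max A₁ A₀) (max A₂ A₃), lt_of_lt_of_le hA₁ ((le_max_left _ _).trans (le_max_left _ _)), C_e * (3 * K),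
    fun u hu z hz hAz hRz hK happ => ?_⟩
  obtain ⟨f, hf, hfε⟩ := happ
  have hA₁z : A₁ ≤ z.im := ((le_max_left _ _).trans (le_max_left _ _)).trans hAz
  have hA₀z : A₀ ≤ z.im := ((le_max_right _ _).trans (le_max_left _ _)).trans hAz
  have hA₂z : A₂ ≤ z.im := ((le_max_left _ _).trans (le_max_right _ _)).trans hAz
  have hA₃z : A₃ ≤ z.im := ((le_max_right _ _).trans (le_max_right _ _)).trans hAz
  have hz0 : 0 < z.im := L.im_pos_of_normThreshold_lt hz
  have hK0 : 0 ≤ K := (HodgeStructure.Polarization.hodgeNorm_nonneg _ _).trans hK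
  set x : ℂ ⊗[ℚ] V := ofRat u with hx_def
  set y : ℝ := z.im with hy_def
  set Pz := L.nilpotentOrbitPolarization z (L.orbitThreshold_lt_im hz) with hPz_def
  -- `N u = 0`
  have hN : L.N.baseChange ℂ x = 0 := by rw [hx_def, ← L.ofRat_N, (hWN u hu z hz hA₁z hRz hK ⟨f, hf, hfε⟩).2, map_zero]
  -- the bounded point `z' = Re z + i A₀`
  set z' : ℂ := (z.re : ℂ) + (A₀ : ℂ) * Complex.I with hz'_def
  have hz're : z'.re = z.re := by simp [hz'_def]
  have hz'im : z'.im = A₀ := by simp [hz'_def]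
  have hz' : L.normThreshold < z'.im := by rw [hz'im]; exact hA₀
  have hRz' : |z'.re| ≤ R := by rw [hz're]; exact hRz
  set Pz' := L.nilpotentOrbitPolarization z' (L.orbitThreshold_lt_im hz') with hPz'_def
  set f' := IsNilpotent.exp ((z' - z) • L.N.baseChange ℂ) f with hf'_def
  have hf' : f' ∈ (L.nilpotentOrbit z' (L.orbitThreshold_lt_im hz')).F p := L.exp_sub_smul_N_apply_mem_nilpotentOrbit_F _ _ hf
  -- exponential factors
  set E : ℝ := y ^ (n_T + n₂) * Real.exp (-α * y) with hE_def
  have hE : E ≤ 1 / (8 * (C_e * C_e * B_T * B₂ + 1)) := hA₂ y hA₂z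
  have hE0 : 0 ≤ E := by positivity
  have hexp8 : Real.exp (-α * y) ≤ 1 / 8 := by have h := hA₃ y hA₃z; rwa [pow_zero, one_mul] at h
  -- (a) closeness at `z'` in the fixed norm: `|x − f'|₀ ≤ B_T B₂ E |x|₀`
  have h1 : L.referenceNorm (x - f') ≤ B_T * y ^ n_T * Pz.hodgeNorm (x - f) :=
    hT z hz hRz z' hz're (by rw [hz'im]; exact hA₀0) (by rw [hz'im]; exact hA₀z) x f hN
  have h2 : Pz.hodgeNorm (x - f) ≤ Real.exp (-α * y) * (B₂ * y ^ n₂ * L.referenceNorm x) :=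
    hfε.trans (mul_le_mul_of_nonneg_left (hB2 z hz hRz x) (Real.exp_pos _).le)
  have h3 : L.referenceNorm (x - f') ≤ B_T * B₂ * E * L.referenceNorm x := by
    calc L.referenceNorm (x - f') ≤ B_T * y ^ n_T * (Real.exp (-α * y) * (B₂ * y ^ n₂ * L.referenceNorm x)) :=
          h1.trans (mul_le_mul_of_nonneg_left h2 (by positivity))
      _ = B_T * B₂ * E * L.referenceNorm x := by rw [hE_def, pow_add]; ring
  -- (b) relative closeness at `z'` in the Hodge norm of `θ(z')`
  have h4 : Pz'.hodgeNorm (x - f') ≤ (C_e * C_e * B_T * B₂ * E) * Pz'.hodgeNorm x := by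
    have ha := (hCe z' hz' hRz' hz'im (x - f')).1
    have hb := (hCe z' hz' hRz' hz'im x).2
    calc Pz'.hodgeNorm (x - f') ≤ C_e * L.referenceNorm (x - f') := ha
      _ ≤ C_e * (B_T * B₂ * E * (C_e * Pz'.hodgeNorm x)) :=
          mul_le_mul_of_nonneg_left (h3.trans (mul_le_mul_of_nonneg_left hb (by positivity))) hC_e
      _ = (C_e * C_e * B_T * B₂ * E) * Pz'.hodgeNorm x := by ring
  have hδ0 : 0 ≤ C_e * C_e * B_T * B₂ * E := by positivity
  have hδ8 : C_e * C_e * B_T * B₂ * E ≤ 1 / 8 := by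
    have hq : 0 < C_e * C_e * B_T * B₂ + 1 := by positivity
    calc C_e * C_e * B_T * B₂ * E ≤ C_e * C_e * B_T * B₂ * (1 / (8 * (C_e * C_e * B_T * B₂ + 1))) :=
          mul_le_mul_of_nonneg_left hE (by positivity)
      _ = (C_e * C_e * B_T * B₂) / (C_e * C_e * B_T * B₂ + 1) / 8 := by field_simp
      _ ≤ 1 / 8 := by
          have : (C_e * C_e * B_T * B₂) / (C_e * C_e * B_T * B₂ + 1) ≤ 1 := (div_le_one hq).2 (by linarith)
          linarith
  -- (c) 2.17 (iii) at `θ(z')` and at `θ(z)`: `‖x‖²_{θ(z')} ≤ 3 Q(u,u) ≤ 6 ‖x‖²_{θ(z)} ≤ 6 K²`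
  have h5 : Pz'.hodgeNorm x ^ 2 ≤ 3 * ((L.Q u u : ℚ) : ℝ) := by
    have h := Pz'.hodgeNorm_ofRat_sq_le_three_mul_form hpk hf' h4 hδ0 hδ8
    rwa [L.nilpotentOrbitPolarization_form] at h
  have h6 : ((L.Q u u : ℚ) : ℝ) ≤ 2 * Pz.hodgeNorm x ^ 2 := by
    have h := Pz.form_le_two_mul_hodgeNorm_ofRat_sq hpk hf hfε (Real.exp_pos _).le hexp8
    rwa [L.nilpotentOrbitPolarization_form] at h
  have h7 : Pz'.hodgeNorm x ^ 2 ≤ (3 * K) ^ 2 := by nlinarith [pow_le_pow_left₀ (Pz.hodgeNorm_nonneg x) hK 2]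
  have h8 : Pz'.hodgeNorm x ≤ 3 * K := (pow_le_pow_iff_left₀ (Pz'.hodgeNorm_nonneg x) (by positivity) two_ne_zero).1 h7
  calc L.referenceNorm x ≤ C_e * Pz'.hodgeNorm x := (hCe z' hz' hRz' hz'im x).2
    _ ≤ C_e * (3 * K) := mul_le_mul_of_nonneg_left h8 hC_e

/-- **CDK Thm. 2.16 (i), `r = 1`: «there are only finitely many» such `u`** — the `u ∈ Λ` which at some `θ(z)` with `Im z ≥ A`,
`|Re z| ≤ R`, have `‖1 ⊗ u‖_{θ(z)} ≤ K` and are `e^{−α Im z}`-close to `F^pθ(z)` form a finite set (bounded in `|·|₀`, §2, inside the lattice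
`Λ`: `Motives/HodgeStructureHodgeNormLattice`). [cite: CattaniDeligneKaplan1995, Thm. 2.16 (i) (p. 492) and 4.9 (p. 505)] -/
theorem finite_setOf_approximate_hodgeClasses {p : ℤ} (hpk : p + p = k) (Λ : Submodule ℤ V) (hΛ : Λ.FG) (K R : ℝ) {α : ℝ}
    (hα : 0 < α) :
    ∃ A : ℝ, L.normThreshold < A ∧
      {u : V | u ∈ Λ ∧ ∃ (z : ℂ) (hz : L.normThreshold < z.im), A ≤ z.im ∧ |z.re| ≤ R ∧
        (L.nilpotentOrbitPolarization z (L.orbitThreshold_lt_im hz)).hodgeNorm (ofRat u) ≤ K ∧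
        ∃ f ∈ (L.nilpotentOrbit z (L.orbitThreshold_lt_im hz)).F p,
          (L.nilpotentOrbitPolarization z (L.orbitThreshold_lt_im hz)).hodgeNorm (ofRat u - f) ≤
            Real.exp (-α * z.im) * (L.nilpotentOrbitPolarization z (L.orbitThreshold_lt_im hz)).hodgeNorm (ofRat u)}.Finite := by
  obtain ⟨A, hA, C, hC⟩ := L.exists_forall_referenceNorm_ofRat_le_of_hodgeNorm_sub_le_exp hpk Λ hΛ K R hα
  refine ⟨A, hA, ((L.deltaSplit.sharpPolarization L.isSplitOverR_deltaSplit).finite_setOf_mem_hodgeNorm_ofRat_le_of_fg Λ hΛ C).subset ?_⟩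
  rintro u ⟨hu, z, hz, hAz, hRz, hK, happ⟩
  exact ⟨hu, by rw [← L.referenceNorm_eq]; exact hC u hu z hz hAz hRz hK happ⟩

/-! ## §3 CDK Thm. 2.16 (iii) made exact: `1 ⊗ u ∈ F^p` for the limit Hodge filtration -/

/-- **CDK Thm. 2.16 (iii), `r = 1`, in threshold form: there is `A` such that every `u ∈ Λ` which at some `θ(z)`, `Im z ≥ A`, `|Re z| ≤ R`,
has `‖1 ⊗ u‖_{θ(z)} ≤ K` and is `e^{−α Im z}`-close to `F^pθ(z)` satisfies `1 ⊗ u ∈ F^p`** (the LIMIT Hodge filtration; «`v` is in `F⁰`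
for some limiting Hodge filtration `F`» — as `N u = 0`, every limiting filtration `exp(zN)·F` contains `1 ⊗ u` as soon as one does).
Proof: offenders range in the finite set of §2, so one `u` offends at points `z_n` with `Im z_n → ∞`; `N u = 0` and
`dist₀(1 ⊗ u, F^p) ≤ B (Im z_n)^m e^{−α Im z_n} K → 0` (`…BoundedPointTransfer` §4), and `F^p` is closed.
[cite: CattaniDeligneKaplan1995, Thm. 2.16 (iii) (p. 492), 2.19 (p. 493), 4.9 (p. 505)] -/
theorem exists_forall_ofRat_mem_F_of_hodgeNorm_sub_le_exp {p : ℤ} (hpk : p + p = k) (Λ : Submodule ℤ V) (hΛ : Λ.FG) (K R : ℝ)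
    {α : ℝ} (hα : 0 < α) :
    ∃ A : ℝ, L.normThreshold < A ∧ ∀ u ∈ Λ, ∀ (z : ℂ) (hz : L.normThreshold < z.im), A ≤ z.im → |z.re| ≤ R →
      (L.nilpotentOrbitPolarization z (L.orbitThreshold_lt_im hz)).hodgeNorm (ofRat u) ≤ K →
      (∃ f ∈ (L.nilpotentOrbit z (L.orbitThreshold_lt_im hz)).F p,
        (L.nilpotentOrbitPolarization z (L.orbitThreshold_lt_im hz)).hodgeNorm (ofRat u - f) ≤
          Real.exp (-α * z.im) * (L.nilpotentOrbitPolarization z (L.orbitThreshold_lt_im hz)).hodgeNorm (ofRat u)) →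
      ofRat u ∈ L.F p := by
  classical
  obtain ⟨A₁, hA₁, hWN⟩ := L.exists_forall_mem_W_and_N_eq_zero_of_hodgeNorm_sub_le_exp hpk Λ hΛ K R hα
  obtain ⟨A₂, hA₂, C, hC⟩ := L.exists_forall_referenceNorm_ofRat_le_of_hodgeNorm_sub_le_exp hpk Λ hΛ K R hα
  obtain ⟨B₄, hB₄, n₄, h₄⟩ := L.exists_forall_exists_mem_F_referenceNorm_sub_le R
  have hfin := (L.deltaSplit.sharpPolarization L.isSplitOverR_deltaSplit).finite_setOf_mem_hodgeNorm_ofRat_le_of_fg Λ hΛ C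
  suffices h : ∃ A : ℝ, ∀ u ∈ Λ, ∀ (z : ℂ) (hz : L.normThreshold < z.im), A ≤ z.im → |z.re| ≤ R →
      (L.nilpotentOrbitPolarization z (L.orbitThreshold_lt_im hz)).hodgeNorm (ofRat u) ≤ K →
      (∃ f ∈ (L.nilpotentOrbit z (L.orbitThreshold_lt_im hz)).F p,
        (L.nilpotentOrbitPolarization z (L.orbitThreshold_lt_im hz)).hodgeNorm (ofRat u - f) ≤
          Real.exp (-α * z.im) * (L.nilpotentOrbitPolarization z (L.orbitThreshold_lt_im hz)).hodgeNorm (ofRat u)) → ofRat u ∈ L.F p by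
    obtain ⟨A, hA⟩ := h
    exact ⟨max A (L.normThreshold + 1), lt_of_lt_of_le (lt_add_one _) (le_max_right _ _),
      fun u hu z hz hAz hRz hK happ => hA u hu z hz ((le_max_left _ _).trans hAz) hRz hK happ⟩
  by_contra hcon
  push Not at hcon
  choose u huΛ z hz hAz hRz huK happ hnot using fun n : ℕ => hcon (max (max A₁ A₂) n)
  choose f hf hfε using happ
  have hK0 : 0 ≤ K := (HodgeStructure.Polarization.hodgeNorm_nonneg _ _).trans (huK 0)
  have hA₁n : ∀ n, A₁ ≤ (z n).im := fun n => ((le_max_left _ _).trans (le_max_left _ _)).trans (hAz n)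
  have hA₂n : ∀ n, A₂ ≤ (z n).im := fun n => ((le_max_right _ _).trans (le_max_left _ _)).trans (hAz n)
  have hlim : Tendsto (fun n => (z n).im) atTop atTop :=
    tendsto_atTop_mono (fun n => (le_max_right _ _).trans (hAz n)) tendsto_natCast_atTop_atTop
  -- the offenders lie in a finite set: one `û` offends infinitely often
  set S := {u : V | u ∈ Λ ∧ (L.deltaSplit.sharpPolarization L.isSplitOverR_deltaSplit).hodgeNorm (ofRat u) ≤ C} with hS_def
  have huS : ∀ n, u n ∈ S := fun n => ⟨huΛ n, by
    rw [← L.referenceNorm_eq]; exact hC (u n) (huΛ n) (z n) (hz n) (hA₂n n) (hRz n) (huK n) ⟨f n, hf n, hfε n⟩⟩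
  haveI : Finite S := hfin.to_subtype
  obtain ⟨⟨û, hûS⟩, hinf⟩ := Finite.exists_infinite_fiber fun n : ℕ => (⟨u n, huS n⟩ : S)
  have hinf' : Set.Infinite {n : ℕ | u n = û} := by
    have h := Set.infinite_coe_iff.1 hinf
    refine Set.Infinite.mono (fun n hn => ?_) h
    simp only [Set.mem_preimage, Set.mem_singleton_iff, Subtype.mk.injEq] at hn
    exact hn
  obtain ⟨φ, hφ, huφ⟩ := extraction_of_frequently_atTop (Nat.frequently_atTop_iff_infinite.2 hinf')
  have hlimφ : Tendsto (fun j => (z (φ j)).im) atTop atTop := hlim.comp hφ.tendsto_atTop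
  -- `N û = 0`
  have hNû : L.N.baseChange ℂ (ofRat û) = 0 := by
    have h := (hWN (u (φ 0)) (huΛ (φ 0)) (z (φ 0)) (hz (φ 0)) (hA₁n (φ 0)) (hRz (φ 0)) (huK (φ 0)) ⟨f (φ 0), hf (φ 0), hfε (φ 0)⟩).2
    rw [huφ 0] at h
    rw [← L.ofRat_N, h, map_zero]
  -- `dist₀(1 ⊗ û, F^p) ≤ B₄ y^{n₄} e^{−αy} K` along the subsequence
  have hdist : ∀ j, ∃ f₀ ∈ L.F p, L.referenceNorm (ofRat û - f₀) ≤ B₄ * K * ((z (φ j)).im ^ n₄ * Real.exp (-α * (z (φ j)).im)) := by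
    intro j
    set n := φ j with hn_def
    have hz0 : 0 < (z n).im := L.im_pos_of_normThreshold_lt (hz n)
    obtain ⟨f₀, hf₀, hle⟩ := h₄ (z n) (hz n) (hRz n) (ofRat û) hNû p (f n) (by exact hf n)
    refine ⟨f₀, hf₀, hle.trans ?_⟩
    have h2 : (L.nilpotentOrbitPolarization (z n) (L.orbitThreshold_lt_im (hz n))).hodgeNorm (ofRat û - f n) ≤
        Real.exp (-α * (z n).im) * K := by
      have h := hfε n
      rw [huφ j] at h
      exact h.trans (mul_le_mul_of_nonneg_left (by have := huK n; rwa [huφ j] at this) (Real.exp_pos _).le)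
    calc B₄ * (z n).im ^ n₄ * (L.nilpotentOrbitPolarization (z n) (L.orbitThreshold_lt_im (hz n))).hodgeNorm (ofRat û - f n)
        ≤ B₄ * (z n).im ^ n₄ * (Real.exp (-α * (z n).im) * K) := mul_le_mul_of_nonneg_left h2 (by positivity)
      _ = B₄ * K * ((z n).im ^ n₄ * Real.exp (-α * (z n).im)) := by ring
  -- hence `1 ⊗ û ∈ F^p`
  have hmem : ofRat û ∈ L.F p := by
    refine L.mem_F_of_forall_exists_referenceNorm_sub_le fun ε hε => ?_
    have hev : ∀ᶠ j in atTop, (z (φ j)).im ^ n₄ * Real.exp (-α * (z (φ j)).im) < ε / (B₄ * K + 1) :=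
      ((tendsto_pow_mul_exp_neg_mul hα n₄).comp hlimφ).eventually (Iio_mem_nhds (by positivity))
    obtain ⟨j, hj⟩ := hev.exists
    obtain ⟨f₀, hf₀, hle⟩ := hdist j
    refine ⟨f₀, hf₀, hle.trans ?_⟩
    have hq : 0 < B₄ * K + 1 := by positivity
    calc B₄ * K * ((z (φ j)).im ^ n₄ * Real.exp (-α * (z (φ j)).im)) ≤ B₄ * K * (ε / (B₄ * K + 1)) :=
          mul_le_mul_of_nonneg_left hj.le (by positivity)
      _ = (B₄ * K) / (B₄ * K + 1) * ε := by ring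
      _ ≤ 1 * ε := mul_le_mul_of_nonneg_right ((div_le_one hq).2 (by linarith)) hε.le
      _ = ε := one_mul ε
  exact hnot (φ 0) (by rw [huφ 0]; exact hmem)

/-! ## §4 The theorem -/

/-- **Cattani–Deligne–Kaplan, Theorem 2.16, for the one-variable nilpotent orbit** (the approximate version of Thm. 2.5).  Let
`L = (W, F, N, Q)` be a polarized limit mixed Hodge structure of weight `k = p + p` on the finite-dimensional `ℚ`-space `V`, `θ(z) = exp(zN)·F`
its nilpotent orbit (`Im z > β`), `Λ ⊆ V` a finitely generated subgroup, and `K`, `α > 0`, `R` real numbers.  There is `A₁ > β` such that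
for every `u ∈ Λ` which at SOME point `θ(z)` with `Im z ≥ A₁`, `|Re z| ≤ R` has `‖1 ⊗ u‖_{θ(z)} ≤ K` and admits `f ∈ F^pθ(z)` with
`‖1 ⊗ u − f‖_{θ(z)} ≤ e^{−α Im z}‖1 ⊗ u‖_{θ(z)}` (`u ∼_{α,z} F^pθ(z)`, 2.15):
**(ii) `u ∈ W_k`; (4.1.4) `N u = 0`; (iii) `1 ⊗ u ∈ F^p` (the limit Hodge filtration) and `u` is of type `(p, p)` at EVERY point of the
orbit; (i) the set of such `u` is finite.** [cite: CattaniDeligneKaplan1995, Thm. 2.16 (p. 492), 2.15, 2.17, 2.19 (pp. 491–493), 4.1–4.9 (pp. 499–505)]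
[cite: CattaniKaplanSchmid1987, §3 Cor. (3.7)] [cite: Schmid1973, Thm. (6.6) (cite only)] -/
theorem exists_threshold_approximate_integral_hodgeClasses {p : ℤ} (hpk : p + p = k) (Λ : Submodule ℤ V) (hΛ : Λ.FG) (K R : ℝ)
    {α : ℝ} (hα : 0 < α) :
    ∃ A₁ : ℝ, L.normThreshold < A₁ ∧
      (∀ u ∈ Λ, ∀ (z : ℂ) (hz : L.normThreshold < z.im), A₁ ≤ z.im → |z.re| ≤ R →
        (L.nilpotentOrbitPolarization z (L.orbitThreshold_lt_im hz)).hodgeNorm (ofRat u) ≤ K →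
        (∃ f ∈ (L.nilpotentOrbit z (L.orbitThreshold_lt_im hz)).F p,
          (L.nilpotentOrbitPolarization z (L.orbitThreshold_lt_im hz)).hodgeNorm (ofRat u - f) ≤
            Real.exp (-α * z.im) * (L.nilpotentOrbitPolarization z (L.orbitThreshold_lt_im hz)).hodgeNorm (ofRat u)) →
        u ∈ L.W k ∧ L.N u = 0 ∧ ofRat u ∈ L.F p ∧
          ∀ (z' : ℂ) (hz' : L.orbitThreshold < z'.im), ofRat u ∈ (L.nilpotentOrbit z' hz').piece p p) ∧
      {u : V | u ∈ Λ ∧ ∃ (z : ℂ) (hz : L.normThreshold < z.im), A₁ ≤ z.im ∧ |z.re| ≤ R ∧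
        (L.nilpotentOrbitPolarization z (L.orbitThreshold_lt_im hz)).hodgeNorm (ofRat u) ≤ K ∧
        ∃ f ∈ (L.nilpotentOrbit z (L.orbitThreshold_lt_im hz)).F p,
          (L.nilpotentOrbitPolarization z (L.orbitThreshold_lt_im hz)).hodgeNorm (ofRat u - f) ≤
            Real.exp (-α * z.im) * (L.nilpotentOrbitPolarization z (L.orbitThreshold_lt_im hz)).hodgeNorm (ofRat u)}.Finite := by
  obtain ⟨A₁, hA₁, hWN⟩ := L.exists_forall_mem_W_and_N_eq_zero_of_hodgeNorm_sub_le_exp hpk Λ hΛ K R hα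
  obtain ⟨A₂, hA₂, hF⟩ := L.exists_forall_ofRat_mem_F_of_hodgeNorm_sub_le_exp hpk Λ hΛ K R hα
  obtain ⟨A₃, hA₃, hfin⟩ := L.finite_setOf_approximate_hodgeClasses hpk Λ hΛ K R hα
  refine ⟨max (max A₁ A₂) A₃, lt_of_lt_of_le hA₁ ((le_max_left _ _).trans (le_max_left _ _)), fun u hu z hz hAz hRz hK happ => ?_,
    hfin.subset ?_⟩
  · obtain ⟨hW, hN⟩ := hWN u hu z hz (((le_max_left _ _).trans (le_max_left _ _)).trans hAz) hRz hK happ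
    have hFp := hF u hu z hz (((le_max_right _ _).trans (le_max_left _ _)).trans hAz) hRz hK happ
    have hN' : L.N.baseChange ℂ (ofRat u) = 0 := by rw [← L.ofRat_N, hN, map_zero]
    refine ⟨hW, hN, hFp, fun z' hz' => ?_⟩
    rw [L.mem_nilpotentOrbit_piece_iff_of_N_apply_eq_zero hz' hpk hN', conj_ofRat]
    exact ⟨hFp, hFp⟩
  · rintro u ⟨hu, z, hz, hAz, hRz, hK, happ⟩
    exact ⟨hu, z, hz, (le_max_right _ _).trans hAz, hRz, hK, happ⟩

/-- **The sequence form (CDK 2.19)**: if `u_n ∈ Λ`, `|Re z_n| ≤ R`, `Im z_n → ∞`, `‖1 ⊗ u_n‖_{θ(z_n)} ≤ K` and `u_n ∼_{α,z_n} F^pθ(z_n)`, then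
for all large `n`: `u_n ∈ W_k`, `N u_n = 0`, `1 ⊗ u_n ∈ F^p`, `u_n` is of type `(p,p)` at every point; and the `u_n` (for large `n`)
range in a finite set («it has a subsequence for which `u(n)` is constant, in `W₀`, and in `F⁰` for some limiting Hodge filtration»).
[cite: CattaniDeligneKaplan1995, 2.19 (p. 493) and Thm. 2.16 (p. 492)] -/
theorem eventually_mem_W_and_N_eq_zero_and_mem_F_of_seq {p : ℤ} (hpk : p + p = k) (Λ : Submodule ℤ V) (hΛ : Λ.FG) (K R : ℝ)
    {α : ℝ} (hα : 0 < α) (u : ℕ → V) (z : ℕ → ℂ) (hz : ∀ n, L.normThreshold < (z n).im)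
    (hlim : Tendsto (fun n => (z n).im) atTop atTop) (hRz : ∀ n, |(z n).re| ≤ R) (hu : ∀ n, u n ∈ Λ)
    (hK : ∀ n, (L.nilpotentOrbitPolarization (z n) (L.orbitThreshold_lt_im (hz n))).hodgeNorm (ofRat (u n)) ≤ K)
    (happ : ∀ n, ∃ f ∈ (L.nilpotentOrbit (z n) (L.orbitThreshold_lt_im (hz n))).F p,
      (L.nilpotentOrbitPolarization (z n) (L.orbitThreshold_lt_im (hz n))).hodgeNorm (ofRat (u n) - f) ≤
        Real.exp (-α * (z n).im) * (L.nilpotentOrbitPolarization (z n) (L.orbitThreshold_lt_im (hz n))).hodgeNorm (ofRat (u n))) :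
    (∀ᶠ n in atTop, u n ∈ L.W k ∧ L.N (u n) = 0 ∧ ofRat (u n) ∈ L.F p ∧
      ∀ (z' : ℂ) (hz' : L.orbitThreshold < z'.im), ofRat (u n) ∈ (L.nilpotentOrbit z' hz').piece p p) ∧
      ∃ s : Set V, s.Finite ∧ ∀ᶠ n in atTop, u n ∈ s := by
  obtain ⟨A₁, hA₁, h, hfin⟩ := L.exists_threshold_approximate_integral_hodgeClasses hpk Λ hΛ K R hα
  have hev : ∀ᶠ n in atTop, A₁ ≤ (z n).im := hlim.eventually (eventually_ge_atTop A₁)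
  exact ⟨hev.mono fun n hn => h (u n) (hu n) (z n) (hz n) hn (hRz n) (hK n) (happ n),
    ⟨_, hfin, hev.mono fun n hn => ⟨hu n, z n, hz n, hn, hRz n, hK n, happ n⟩⟩⟩

end PolarizedLimitMixedHodgeStructure

end HodgeTheory

end Literature.AlgebraicGeometry

end
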